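import Summits.RiemannHypothesis.RiemannHypothesis.Theorems.WeilFormatCDataRungJ
import Literature.NumberTheory.LFunctions.YoshidaWindowGramFrontDoorJ
import Summits.RiemannHypothesis.RiemannHypothesis.Theorems.WeilFormatCDataKitW
import HarnessLib

/-!
# Format C: the KERNEL front door at tail order `J` — data kit for `weilPositivityOn_of_formatC_dataJ`

Helper file of the rh-explicit Weil-positivity programme (`--supports stmt-RiemannHypothesis-0098`; seat
rh-explicit-weil-2), RH-free, no definitions, no named facts.  It composes weil-10's ORDER-`J` data front door
`WeilFormatC.weilPositivityOn_of_formatC_dataJ` (two kernel PSD facts + finitely many numeric inequalities ⟹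
`WeilPositivityOn a`; exact columns only on `[B, B₃)` with `B₃ ≥ 2B`, Hankel tail of order `J` beyond) with weil-2's
kernel evaluator (`Literature/…/YoshidaWindowGram{Enclosure, Records, EntryBox, Columns, FrontDoor, FrontDoorW, TailJ,
TailJBox, FrontDoorJ}.lean`): every remaining hypothesis is (i) a validity fact delivered by a `decide +kernel` data
certificate (`ConstsValid`, `FDValid`, `PrimeData`, `TabValid`, `TabColValid`), (ii) an entrywise enclosure `near` of
the per-sector Schur matrix with the ORDER-`J` tail (`Encl.even_front_nearJ` / `Encl.odd_front_nearJW`, assembled from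
row bands — the per-declaration kernel budget, KERNEL-CAP.md), (iii) a `PsdDyadic.checkPsdMid` verdict on those
midpoints, or (iv) an INTEGER comparison of a box endpoint (far-diagonal positivity, the constant even weight
`w = wz·2^{−cd}`, the tail bases `d₀ = d0z·2^{−cd}`); the odd column weights are per column (`Encl.checkWeightsOdd`).
The Peter–Paul parameters are rationals `θ = θn/θd`, `η = ηn/ηd` per sector.
-/

set_option linter.dupNamespace false
set_option autoImplicit false

noncomputable section

open Complex Finset Matrix
open scoped Real BigOperators ArithmeticFunction.vonMangoldt

namespace Summit.RiemannHypothesis.RiemannHypothesis.Theorems.WeilFormatC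

open Literature.NumberTheory.LFunctions Literature.NumberTheory.LFunctions.Yoshida1992
  Literature.NumberTheory.LFunctions.Yoshida1992.Encl Literature.Analysis.SpecialFunctions
  Literature.Analysis.ValidatedNumerics.NumericsMP

variable {a : ℝ} {S : ℕ} {ks : List PrimeLen} {C : Consts} {F : FDConsts}

/-- **`WeilPositivityOn a` from the order-`J` data kit.**  All hypotheses are delivered by `decide +kernel`
certificates of the generated rung files (validity of constants / front-door constants / prime data / tables, the
two `near` enclosures with the order-`J` tail boxes, the odd column weights, the two `PsdDyadic` verdicts) or are
integer comparisons of box endpoints. -/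
theorem weilPositivityOn_of_kitJ (ha : 0 < a) (hS : 0 < S) (hC : ConstsValid S a ks C)
    (hF : FDValid S a F) {tab : List IdxRec}
    -- EVEN sector
    {Be B3e : ℕ} (hBe : 2 ≤ Be) (hBBe : 2 * Be ≤ B3e) (hTe : TabValid S a ks (Be + 1) tab) (Je : ℕ) {θne θde ηne ηde : ℕ}
    (hθne : 0 < θne) (hθde : 0 < θde) (hηne : 0 < ηne) (hηde : 0 < ηde) {ctabE : List IdxRec}
    (hCTe : TabColValid S a ks Be (B3e + 1) ctabE)
    {ce cde wze d0ze pe qe : ℕ} (hwze : 0 < wze) (hd0ze : 0 < d0ze) (hsqe : checkSqrtUpper 8 (Be - 1) pe qe = true)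
    (h0e : 0 < (devEvenBox S C F (tget tab Be) Be pe qe).lo)
    (hwe : (wze : ℤ) * (S : ℤ) ≤ (devEvenBox S C F (tget tab Be) Be pe qe).lo * 2 ^ cde)
    (hd0e : (d0ze : ℤ) * (S : ℤ) ≤ (devEvenBox S C F (tget ctabE B3e) B3e pe qe).lo * 2 ^ cde)
    {ρe δe : ℤ} {DSe Le : List (List ℤ)} (hPe : PsdDyadic.checkPsdMid Be δe ρe DSe Le = true)
    (hneare : ∀ i j : Fin Be,
      |((if (i : ℕ) = 0 then gramCoeff a 0 j else if (j : ℕ) = 0 then gramCoeff a i 0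
          else (gramCoeff a i j + gramCoeff a i (-(j : ℤ))) / 2)
        - (∑ m ∈ Finset.Ico Be B3e, (if (i : ℕ) = 0 then gramCoeff a 0 m else if m = 0 then gramCoeff a i 0
            else (gramCoeff a i m + gramCoeff a i (-(m : ℤ))) / 2) *
            (if (j : ℕ) = 0 then gramCoeff a 0 m else if m = 0 then gramCoeff a j 0
            else (gramCoeff a j m + gramCoeff a j (-(m : ℤ))) / 2) / ((fun _ : ℕ ↦ (wze : ℝ) * (1 / 2 ^ cde)) m))
        - U2EvenJ a ((θne : ℝ) / θde) ((ηne : ℝ) / ηde) ((d0ze : ℝ) * (1 / 2 ^ cde)) Be B3e Je i j)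
        - (PsdDyadic.getMZ DSe i j : ℝ) * (1 / 2 ^ ce)| ≤ (ρe : ℝ) * (1 / 2 ^ ce))
    -- ODD sector
    {Bo B3o : ℕ} (hBo : 1 ≤ Bo) (hBBo : 2 * Bo ≤ B3o) (Jo : ℕ) {θno θdo ηno ηdo : ℕ}
    (hθno : 0 < θno) (hθdo : 0 < θdo) (hηno : 0 < ηno) (hηdo : 0 < ηdo) {ctabO : List IdxRec}
    (hCTo : TabColValid S a ks Bo (B3o + 2) ctabO)
    {co cdo d0zo po qo Ksero qr : ℕ} {wso rso : List ℕ} (hd0zo : 0 < d0zo) (hsqo : checkSqrtUpper 8 Bo po qo = true)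
    (h0o : 0 < (devOddBox S C F (tget ctabO (Bo + 1)) Bo Bo po qo).lo)
    (hWo : checkWeightsOdd S Ksero C F ctabO Bo (B3o - Bo) cdo wso rso qr po qo = true)
    (hd0o : (d0zo : ℤ) * (S : ℤ) ≤ (devOddBox S C F (tget ctabO (B3o + 1)) B3o Bo po qo).lo * 2 ^ cdo)
    {ρo δo : ℤ} {DSo Lo : List (List ℤ)} (hPo : PsdDyadic.checkPsdMid Bo δo ρo DSo Lo = true)
    (hnearo : ∀ k k' : Fin Bo,
      |(((gramCoeff a (((k : ℕ) : ℤ) + 1) (((k' : ℕ) : ℤ) + 1) - gramCoeff a (((k : ℕ) : ℤ) + 1) (-(((k' : ℕ) : ℤ) + 1))) / 2)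
        - (∑ l ∈ Finset.Ico Bo B3o, ((gramCoeff a (((k : ℕ) : ℤ) + 1) ((l : ℤ) + 1) - gramCoeff a (((k : ℕ) : ℤ) + 1) (-((l : ℤ) + 1))) / 2) *
            ((gramCoeff a (((k' : ℕ) : ℤ) + 1) ((l : ℤ) + 1) - gramCoeff a (((k' : ℕ) : ℤ) + 1) (-((l : ℤ) + 1))) / 2) /
              (woF wso cdo Bo l))
        - U2OddJ a ((θno : ℝ) / θdo) ((ηno : ℝ) / ηdo) ((d0zo : ℝ) * (1 / 2 ^ cdo)) Bo B3o Jo k k')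
        - (PsdDyadic.getMZ DSo k k' : ℝ) * (1 / 2 ^ co)| ≤ (ρo : ℝ) * (1 / 2 ^ co)) :
    WeilPositivityOn a := by
  have hSr : (0 : ℝ) < S := by exact_mod_cast hS
  -- EVEN numeric facts
  have hBe1 : 1 ≤ Be := by omega
  have hreBe : MI.mem S (reDigammaQuarter (freq a Be)) (tget tab Be).reP := (hTe Be (by omega)).2.reP
  have hreB3e : MI.mem S (reDigammaQuarter (freq a B3e)) (tget ctabE B3e).reP := (hCTe B3e (by omega) (by omega)).2
  have hloBe := devEvenBox_lo_le hS ha hC hF hreBe (by omega) hsqe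
  have hloB3e := devEvenBox_lo_le hS ha hC hF hreB3e (by omega) hsqe
  have h0e' : 0 < devEven a Be Be := by
    have : (0 : ℝ) < (devEvenBox S C F (tget tab Be) Be pe qe).lo := by exact_mod_cast h0e
    nlinarith
  have hwe' : (wze : ℝ) * (1 / 2 ^ cde) ≤ devEven a Be Be := dyadic_le_of_lo hS hwe hloBe
  have hd0e' : (d0ze : ℝ) * (1 / 2 ^ cde) ≤ devEven a Be B3e := dyadic_le_of_lo hS hd0e hloB3e
  have hwpos : (0 : ℝ) < (wze : ℝ) * (1 / 2 ^ cde) := by positivity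
  have hd0pos : (0 : ℝ) < (d0ze : ℝ) * (1 / 2 ^ cde) := by positivity
  have hθe : (0 : ℝ) < (θne : ℝ) / θde := by positivity
  have hηe : (0 : ℝ) < (ηne : ℝ) / ηde := by positivity
  -- ODD numeric facts
  have hreBo : MI.mem S (reDigammaQuarter (freq a ((Bo : ℤ) + 1))) (tget ctabO (Bo + 1)).reP := by
    have h := (hCTo (Bo + 1) (by omega) (by omega)).2
    push_cast at h; exact h
  have hreB3o : MI.mem S (reDigammaQuarter (freq a ((B3o : ℤ) + 1))) (tget ctabO (B3o + 1)).reP := by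
    have h := (hCTo (B3o + 1) (by omega) (by omega)).2
    push_cast at h; exact h
  have hloBo := devOddBox_lo_le hS ha hC hF hreBo (by omega) hsqo
  have hloB3o := devOddBox_lo_le hS ha hC hF hreB3o (by omega) hsqo
  have h0o' : 0 < devOdd0 a Bo Bo := by
    have : (0 : ℝ) < (devOddBox S C F (tget ctabO (Bo + 1)) Bo Bo po qo).lo := by exact_mod_cast h0o
    nlinarith
  have hd0o' : (d0zo : ℝ) * (1 / 2 ^ cdo) ≤ devOdd0 a Bo B3o := dyadic_le_of_lo hS hd0o hloB3o
  have hd0opos : (0 : ℝ) < (d0zo : ℝ) * (1 / 2 ^ cdo) := by positivity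
  have hθo : (0 : ℝ) < (θno : ℝ) / θdo := by positivity
  have hηo : (0 : ℝ) < (ηno : ℝ) / ηdo := by positivity
  have hWts := weights_of_checkOdd hS ha hC hF (by omega) hsqo hCTo (by omega) hWo
  refine weilPositivityOn_of_formatC_dataJ ha hBe hBBe Je (θe := (θne : ℝ) / θde) (ηe := (ηne : ℝ) / ηde)
    (d0e := (d0ze : ℝ) * (1 / 2 ^ cde)) hθe hηe (fun _ ↦ (wze : ℝ) * (1 / 2 ^ cde)) ?_ ?_ ?_ ?_
    hBo hBBo Jo (θo := (θno : ℝ) / θdo) (ηo := (ηno : ℝ) / ηdo) (d0o := (d0zo : ℝ) * (1 / 2 ^ cdo)) hθo hηo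
    (woF wso cdo Bo) ?_ ?_ ?_ ?_
  · -- h0e
    have h := h0e'; unfold devEven at h; exact h
  · -- hd0e
    refine ⟨hd0pos, ?_⟩
    have h := hd0e'; unfold devEven at h; exact h
  · -- hwe
    intro m hm _
    refine ⟨hwpos, ?_⟩
    have h := hwe'.trans (devEven_mono ha hBe1 hm)
    unfold devEven at h; exact h
  · -- hSe
    intro x
    refine PsdDyadic.psd_of_checkPsdMid hPe (u := 1 / 2 ^ ce) (by positivity) _ (fun i j ↦ ?_) x
    have h := hneare i j
    rw [← U2EvenJ_fin] at h
    exact h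
  · -- h0o
    have h := h0o'; unfold devOdd0 at h; exact h
  · -- hd0o
    refine ⟨hd0opos, ?_⟩
    have h := hd0o'; unfold devOdd0 at h; exact h
  · -- hwo (per column)
    intro l hl hlB
    have h := hWts l hl (by omega)
    unfold devOddA at h
    exact h
  · -- hSo
    intro x
    refine PsdDyadic.psd_of_checkPsdMid hPo (u := 1 / 2 ^ co) (by positivity) _ (fun k k' ↦ ?_) x
    have h := hnearo k k'
    rw [← U2OddJ_fin] at h
    exact h

end Summit.RiemannHypothesis.RiemannHypothesis.Theorems.WeilFormatC

end
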